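import Summits.ResolutionOfSingularities.ResolutionOfSingularities.Theses.FrobeniusLadder
import Summits.ResolutionOfSingularities.ResolutionOfSingularities.Theorems.FrobeniusLadderFInjectiveMacaulayficationOfLocalDoorAdmFactOffClosed
import Summits.ResolutionOfSingularities.ResolutionOfSingularities.Theorems.FrobeniusLadderFInjectiveMacaulayficationLocalFullificationFibreAdmGe4Split
import Literature.AlgebraicGeometry.Resolution.MacaulayficationBlowupForm
import Summits.ResolutionOfSingularities.ResolutionOfSingularities.Theorems.FrobeniusLadderFInjectiveMacaulayficationRegularOffFiniteOfLRAdm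
import Summits.ResolutionOfSingularities.ResolutionOfSingularities.Theorems.FrobeniusLadderFInjectiveMacaulayficationOfTrRungs
import Summits.ResolutionOfSingularities.ResolutionOfSingularities.Theorems.FrobeniusLadderFInjectiveMacaulayficationLRadmIffTr
import HarnessLib

/-!
# Crux `FInjectiveMacaulayfication` (stmt-ResolutionOfSingularities-15315) — SKELETON v38 «CLOSED-POINT DOOR» (line LD, programmes «AD» + «CZ» + the Tr-rung re-lettering)
(lead res-L1-w45a-lead-1 g8; plan-1 RULING R17.13 (2) / GO v38 2026-08-28T04:25:17Z / NOTE OF RECORD 04:27:45Z: v37 `23e0251bb675705f` → v38 = v37 with EXACTLY ONE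
stub re-lettered — the resolution-side research stub (LR_adm) «local resolution of admissible fibre-singular blow-ups at NON-CLOSED points of local dimension ≥ 4»
↦ its CLOSED-POINT form over IMPERFECT finitely generated ground fields `∀ p e r, p.Prime → 4 ≤ e → 1 ≤ r → ClosedPointLocalResolutionAdmTr p e r`
(res-L1-w45a-stub-3 p602502); the two are EQUIVALENT in the kernel (`LRadmIffTr.localResolutionNonClosedGe4Adm_iff_tr`, stub-3 p604770 — the spreading-out
converse), so the CONTENT of the residue is unchanged and only what the stub SAYS changes: «closed-point admissible local uniformization of e-folds, e ≥ 4, over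
k(s₁,…,s_r), r ≥ 1» — Cossart–Piltant's own class of ground fields, one dimension up. `stub_namedFacts` (four published theorems, text (B)) and the F-half
`stub_localFInjectivizationFibreAdmGe4` are byte-identical to v37.)

[OURS · L1 W4.5a] Skeleton file (`ledger skeleton check … --crux stmt-ResolutionOfSingularities-15315`); sorries ONLY in `stub_*`; the deciding
theorem `FInjectiveMacaulayfication_proof` concludes the route decl BY NAME. AI-written (AI review is weaker than expert review).

THE LINE (plan-1 R17.4 FINDING, confirmed by the I-A author): Temkin's Noetherian induction [Temkin 2008, Prop. 2.3.4; tree: res-L1-w45a-stub-3's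
`DesingularizationOffClosedPointsGen` p587470 = lead-1's `DesingularizationOffClosedPoints` p582779 with the d-uniform interface] uses NO maximality and
NO dimension: given LOCAL RESOLUTION of the blow-ups of `Spec 𝒪_{X,x}` at the NON-CLOSED points, ONE `Sing`-supported blowing up makes an integral
variety `X` of ANY dimension regular at every point with non-closed image; the residual image is a closed set of closed points, hence FINITE; at each
residual closed point `b` (local dimension `d = dim X`) the local scheme `X′ ×_X Spec 𝒪_b` is regular off its closed fibre, Cohen–Macaulay after ONE further
fibre-supported blowing up [Česnavičius 2021, Thm 5.3], and LOCAL F-INJECTIVIZATION with a FIBRE-SUPPORTED centre (F_adm(d)) finishes (F-Temkin step, stub-2's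
`FTemkinClosedPointsGen`; spread by Temkin Lemma 2.1.1). Below local dimension 4 local resolution is Cossart–Piltant [CP 2019 Thm 1.1 + Prop 4.4 + R–G 081R].
A NON-closed point `x` of local dimension `e` of a `k`-variety is a CLOSED point of an `e`-fold over `K = k(s₁,…,s_r)`, `r = trdeg_k κ(x) ≥ 1`, with the same
local ring (`ClosedPointLocalResolutionAdmTr.exists_closedPoint_model_pos`), and conversely every such closed point spreads out to a non-closed point of a
`k`-variety (`LRadmIffTr.exists_spread_ring`). Hence the crux factors through exactly TWO statements:

* (CPLRA-Tr) `ClosedPointLocalResolutionAdmTr.ClosedPointLocalResolutionAdmTr p e r` for all primes `p`, all `e ≥ 4`, all `r ≥ 1` (stub-3 p602502): for every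
  field `k` of characteristic `p`, every integral separated finite-type `e`-fold `Y` over `K := FractionRing (MvPolynomial (Fin r) k)` and every CLOSED `y ∈ Y`,
  every blowing up `S′ → Spec 𝒪_{Y,y}` along an ADMISSIBLE centre (`supp I ⊆ (Reg Spec 𝒪_{Y,y})ᶜ`) that is singular only on the closed fibre admits a
  desingularization — `stub_closedPointLocalResolutionAdmTr`; ⟺ (LR_adm) (p604770); levels `e ≤ 3` are Cossart–Piltant and NOT consumed; on `d`-folds only the
  levels `4 ≤ e ≤ d − 1` are consumed (`localBody_at_nonClosed_of_tr_lt`), so the stub is VACUOUS on 4-folds;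
* (F_adm) `LocalFullificationFibreAdmGe4Split.LocalFInjectivizationFibreAdmGe4` (stub-2 p591179; the F-HALF of (LF_adm) p591104): ∀ d ≥ 4, at a CLOSED SINGULAR
  `x` with `dim 𝒪_x = d`, a blowing up `S′` of `Spec 𝒪_{X,x}` along an admissible `I ≠ ⊥`, regular off its closed fibre and COHEN–MACAULAY everywhere, admits a
  fibre-supported `𝓚 ≠ ⊥` all of whose blowing ups are FULL at every point — `stub_localFInjectivizationFibreAdmGe4`;

assembled by `OfTrRungs.fInjectiveMacaulayfication_of_trRungs_of_cesnaviciusOffClosed` (stub-3 p605078 = stub-2's v37 assembly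
`OfLocalDoorAdmFactOffClosed.fInjectiveMacaulayfication_of_localDoorAdm_of_factOffClosed` p601041 ∘ `ClosedPointLocalResolutionAdmTr.localResolutionNonClosedGe4Adm_of_tr`).
HOLE MAP / PER-DIMENSION SLICES OF RECORD (stub-3 `DimSliceOfCesnavicius` p604730): dim ≤ 4 ⟸ the four published theorems ∧ F(4), NO resolution residue ·
dim ≤ 5 ⟸ + CPLRA-Tr(p, 4, r ≥ 1) ∧ F(5) · dim ≤ d ⟸ + CPLRA-Tr(p, e, r ≥ 1) for 4 ≤ e ≤ d − 1 ∧ F(4..d).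
Dossier: `Lines/v38-dossier.md` (= v37-dossier + the iff + the slices).
-/

-- single-problem summit: the doubled namespace component is forced
set_option linter.dupNamespace false

noncomputable section

namespace Summit.ResolutionOfSingularities.ResolutionOfSingularities.Cruxes.FInjectiveMacaulayfication.Sketch

open AlgebraicGeometry CategoryTheory Literature.AlgebraicGeometry.Resolution

/-- NAMED FACTS BY NAME (the ONE registered named-fact stub, NEVER a prover target). v37 (plan-1 R17.12 (2a)): EXACTLY the four published theorems the
door consumes — Cossart–Piltant 2019 Thm 1.1 (`CossartPiltant2019General`) · Raynaud–Gruson flattening = Stacks 081R (`Stacks081R`) · Cossart–Piltant 2019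
Prop 4.4 (`CossartPiltant2019Principalization`) · **Česnavičius 2021 Thm 5.3, Macaulayfication by ONE blowing up with centre inside a prescribed closed set off
which the scheme is Cohen–Macaulay (`CesnaviciusBlowupMacaulayficationOffClosed`, text (B), the weakest admitted premise; admitted by director-resolution DR-CZ3
2026-08-28T03:40Z, Literature p602953)**; the unconsumed Datta–Murayama / Lipman conjuncts of v31–v36.2 are DROPPED.
[cite: CossartPiltant2019, Thm. 1.1; Prop. 4.4] [cite: StacksProject, Tag 081R] [cite: Cesnavicius2021, Thm. 5.3] -/
theorem stub_namedFacts :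
    Literature.AlgebraicGeometry.Resolution.CossartPiltant2019General.{0} ∧ Literature.AlgebraicGeometry.Resolution.Stacks081R.{0} ∧ Literature.AlgebraicGeometry.Resolution.CossartPiltant2019Principalization.{0} ∧
      Literature.AlgebraicGeometry.Resolution.CesnaviciusBlowupMacaulayficationOffClosed.{0} := by
  sorry

/-- STUB (CPLRA-Tr) — **CLOSED-POINT ADMISSIBLE LOCAL RESOLUTION OF `e`-FOLDS, `e ≥ 4`, OVER THE IMPERFECT FIELDS `k(s₁,…,s_r)`, `r ≥ 1`**
(`ClosedPointLocalResolutionAdmTr.ClosedPointLocalResolutionAdmTr p e r` BY NAME, res-L1-w45a-stub-3 p602502; Temkin 2008 Prop. 2.3.4 (iii) category; plan-1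
R17.13 (2) / GO v38): for every prime `p`, every `e ≥ 4`, every `r ≥ 1`, every field `k` of characteristic `p`, every INTEGRAL separated finite-type scheme `Y`
over `K := FractionRing (MvPolynomial (Fin r) k)` with `dim Y = e`, and every CLOSED point `y ∈ Y`: every blowing up `S′ → Spec 𝒪_{Y,y}` along `I` with
`supp I ⊆ (Reg Spec 𝒪_{Y,y})ᶜ` whose singular points lie on the closed fibre admits a desingularization (`Scheme.AdmitsDesingularization`). EQUIVALENT to
v37's (LR_adm) `RegularOffFiniteOfLRAdm.LocalResolutionNonClosedGe4Adm` by `LRadmIffTr.localResolutionNonClosedGe4Adm_iff_tr` (p604770); implied by the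
all-fields rung `ClosedPointLocalResolutionAdm p e` (`closedPointLocalResolutionAdmTr_of_adm`). The levels `e ≤ 3` are Cossart–Piltant [CP 2019] and are not
part of the stub; on `d`-folds only `4 ≤ e ≤ d − 1` is consumed (vacuous when `dim X ≤ 4`); ≤ S_loc (tri-2 `readTr`). The residue of the crux BELOW the top
dimension, now in Cossart–Piltant's own language (closed points, imperfect finitely generated ground fields) one dimension up.
[conjecture · OURS · v38 registered stub] -/
theorem stub_closedPointLocalResolutionAdmTr :
    ∀ p e r : ℕ, p.Prime → 4 ≤ e → 1 ≤ r →
      Summit.ResolutionOfSingularities.ResolutionOfSingularities.Theorems.FInjectiveMacaulayfication.ClosedPointLocalResolutionAdmTr.ClosedPointLocalResolutionAdmTr p e r := by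
  sorry

/-- STUB (F_adm) — **LOCAL F-INJECTIVIZATION OF COHEN–MACAULAY ADMISSIBLE BLOW-UPS AT CLOSED SINGULAR POINTS, FIBRE-SUPPORTED CENTRE, EVERY LOCAL DIMENSION d ≥ 4**
(`LocalFullificationFibreAdmGe4Split.LocalFInjectivizationFibreAdmGe4` BY NAME, res-L1-w45a-stub-2 p591179 = the F-HALF of (LF_adm) p591104; plan-1 R17.7 (4) CZ /
R17.9): at a CLOSED point `x ∉ Reg X` with `dim 𝒪_{X,x} = d ≥ 4` (`X` integral separated f.t./k, char p), a blowing up `S′` of `Spec 𝒪_{X,x}` along `I ≠ ⊥` with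
`supp I ⊆ (Reg Spec 𝒪_{X,x})ᶜ`, regular off its closed fibre and Cohen–Macaulay at EVERY point, admits `𝓚 ≠ ⊥` supported in the closed fibre all of whose
blowing ups are FULL (domain ∧ s.o.p. weakly regular ∧ parameter ideals Frobenius closed) at every point. THE research residue of the F-injective ladder: the
CM-half is print (Česnavičius); positive kernel instances at I = ⊤ in every d ≥ 4 (`GermForm`, Fermat cubic cone char 2, stub-1) and a 1103/1104 census at
d = 4, p = 3 (idea-1 DP4); no counterexample known. [conjecture · OURS · v37/v38 registered stub] -/
theorem stub_localFInjectivizationFibreAdmGe4 : Summit.ResolutionOfSingularities.ResolutionOfSingularities.Theorems.FInjectiveMacaulayfication.LocalFullificationFibreAdmGe4Split.LocalFInjectivizationFibreAdmGe4 := by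
  sorry

/-- **THE DECIDING THEOREM (v38, line LD, closed-point door)**: the crux `FInjectiveMacaulayfication` BY NAME from the named bundle `stub_namedFacts`
(CP 1.1, 081R, CP 4.4, Česnavičius 5.3 (B)), the closed-point resolution rungs (CPLRA-Tr, `e ≥ 4`, `r ≥ 1`) and the F-half (F_adm), by
`OfTrRungs.fInjectiveMacaulayfication_of_trRungs_of_cesnaviciusOffClosed` (stub-3 p605078: stub-2's v37 assembly p601041 ∘ `localResolutionNonClosedGe4Adm_of_tr`).
[OURS assembly; v38] -/
theorem FInjectiveMacaulayfication_proof :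
    Summit.ResolutionOfSingularities.ResolutionOfSingularities.Theses.FrobeniusLadder.FInjectiveMacaulayfication :=
  Summit.ResolutionOfSingularities.ResolutionOfSingularities.Theorems.FInjectiveMacaulayfication.OfTrRungs.fInjectiveMacaulayfication_of_trRungs_of_cesnaviciusOffClosed
    stub_namedFacts.1 stub_namedFacts.2.1 stub_namedFacts.2.2.1 stub_namedFacts.2.2.2
    stub_closedPointLocalResolutionAdmTr stub_localFInjectivizationFibreAdmGe4

/-- AUDIT TWIN (sorry-free given the stubs' statements as hypotheses): the v38 residue is EQUIVALENT to v37's — from (LR_adm) instead of the Tr-rungs, through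
the kernel iff `LRadmIffTr.localResolutionNonClosedGe4Adm_iff_tr` (p604770). [OURS · plumbing; v38] -/
theorem FInjectiveMacaulayfication_of_v37_residue
    (hF : Literature.AlgebraicGeometry.Resolution.CossartPiltant2019General.{0} ∧ Literature.AlgebraicGeometry.Resolution.Stacks081R.{0} ∧
      Literature.AlgebraicGeometry.Resolution.CossartPiltant2019Principalization.{0} ∧ Literature.AlgebraicGeometry.Resolution.CesnaviciusBlowupMacaulayficationOffClosed.{0})
    (hLR : Summit.ResolutionOfSingularities.ResolutionOfSingularities.Theorems.FInjectiveMacaulayfication.RegularOffFiniteOfLRAdm.LocalResolutionNonClosedGe4Adm)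
    (hFadm : Summit.ResolutionOfSingularities.ResolutionOfSingularities.Theorems.FInjectiveMacaulayfication.LocalFullificationFibreAdmGe4Split.LocalFInjectivizationFibreAdmGe4) :
    Summit.ResolutionOfSingularities.ResolutionOfSingularities.Theses.FrobeniusLadder.FInjectiveMacaulayfication :=
  Summit.ResolutionOfSingularities.ResolutionOfSingularities.Theorems.FInjectiveMacaulayfication.OfTrRungs.fInjectiveMacaulayfication_of_trRungs_of_cesnaviciusOffClosed
    hF.1 hF.2.1 hF.2.2.1 hF.2.2.2
    (Summit.ResolutionOfSingularities.ResolutionOfSingularities.Theorems.FInjectiveMacaulayfication.LRadmIffTr.localResolutionNonClosedGe4Adm_iff_tr.mp hLR)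
    hFadm

end Summit.ResolutionOfSingularities.ResolutionOfSingularities.Cruxes.FInjectiveMacaulayfication.Sketch

end
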